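import Literature.IUT.HodgeArakelov.GaloisPairRigidityMonoAnalytic
import Literature.IUT.HodgeArakelov.AbsTopMonoidsGroupificationProofs
import Literature.AnabelianGeometry.AbsoluteAnabelian.MonoidKummerMapsProofs
import HarnessLib

/-!
# [IUTchII] Remark 1.11.1 (i) (a)/(b)/(c): the forgetful maps `Aut(G ↷ O^?(G)) → Aut(G)` are SPLIT SURJECTIVE over
# every inhabitant of the interface — so (a) = injectivity alone (= [AbsTopIII] Prop. 3.2 (iv), PROVED in the tree),
# and (b)/(c) reduce to their kernel clauses (PROOF-ONLY companion)

Mochizuki, *Inter-universal Teichmüller theory II*, §1, Remark 1.11.1 (i), kurims manuscript (Dec. 2020) pp. 49–50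
[claim: Mochizuki2012, status: disputed] (IUTchII §1 Rmk 1.11.1 (i), kurims pp.49-50): "(a) the group of automorphisms
of the MLF-Galois TM-pair `G ↷ O^⊳(G)` maps bijectively [i.e., by forgetting `O^⊳(G)`] onto the group of automorphisms of
the topological group `G` [cf. [AbsTopIII], Proposition 3.2, (iv)]; (b) the group of automorphisms of `G ↷ O^×(G)` maps
surjectively … onto `Aut(G)`, with kernel … the natural action of `Ẑ^×`; (c) … `G ↷ O^ĝp(G)` … by the same proof".

PROOF-ONLY companion (no `def`, no `instance`, no `structure`; abc-iut cell, block C / wave W6, seat abc-iut-w6-d016)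
of abc-iut-L6-t1's `GaloisPairRigidity.lean` (p409065: `PairAut`, `PairAut.forget`, named facts `Rmk1111_a`
(FACT-LIST F-0417, conditional) / `Rmk1111_b` (F-0418, fact-open) / `Rmk1111_c`), of abc-iut-L6-t1/L6-t23's
`GaloisPairRigidityMonoAnalytic.lean` (p412344: `Rmk1111_a_of_monoAnalyticLifts`, conditional on FOUR hypotheses
`hTM`, `hMA`, `hlift`, `hdet`) and of this seat's `AbsTopMonoidsGroupificationProofs.lean` (p428334: `(∗gp)`).

What the kernel says — over ANY `A : AbsTopMonoids S` (no continuity, no TM-pair, no mono-analytic hypothesis):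

* `PairAut.forget_surjective_actOtri` / `PairAut.exists_section_actOtri` — the forgetful map
  `Aut(G ↷ O^⊳(G)) → Aut(G)` is SURJECTIVE, indeed SPLIT by a group homomorphism `σ ↦ (σ, O^⊳(σ))`: this is nothing
  but the FUNCTORIALITY of `(∗⊳)` recorded in the interface (`mapOtri`, `mapOtri_id`, `mapOtri_comp`,
  `mapOtri_equivariant`) — "the isomorphism `(G ↷ O^⊳(G)) ⥲ (G* ↷ O^⊳(G*))` induced by `G ⥲ G*`" IS a pair
  automorphism over `σ` when `G* = G`;
* `PairAut.forget_surjective_actOunits` / `PairAut.exists_section_actOunits` — the same for `G ↷ O^×(G)`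
  (abc-iut-L6-t1's `actOunits`), i.e. the FIRST conjunct of `Rmk1111_b A zhatPow` holds for every `A` and every
  `zhatPow` (`Rmk1111_b_surjective`);
* `PairAut.forget_surjective_ogp` / `PairAut.exists_section_ogp` — the same for `G ↷ O^gp(G)` with the action
  induced on the groupification (`(∗gp)`, p428334: `existsUnique_actOgp`, `existsUnique_mapOgp`, `mapOgp_equivariant`),
  i.e. the first conjunct of the `(∗ĝp) := (∗gp)` reading of `Rmk1111_c`;
* `PairAut.mem_over_one_iff` — a pair over `1 ∈ Aut(G)` is exactly a `G`-equivariant automorphism (bookkeeping for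
  the kernel clauses);
* `Rmk1111_a_iff_forget_injective` — hence (a) `Rmk1111_a A` is EQUIVALENT to the injectivity of the forgetful map
  alone, i.e. to "[cf. [AbsTopIII], Proposition 3.2, (iv)]" — the uniqueness of lifts;
* `Rmk1111_a_of_isTMPair` (`S : ThetaSetting.{0}`) — and since that uniqueness is PROVED in the tree
  (`pairIsoDeterminedByGalois_holds`, abc-iut-L6-t13, FACT-LIST F-0174 «proved»), `Rmk1111_a A` HOLDS for every `A`
  with continuity laws whose pairs `G ↷ O^⊳(G)` are MLF-Galois `TM`-pairs (`A.IsTMPair hA G`, checked at ONE `G` —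
  `Rmk1111_a_of_isTMPair_of_exists`): the hypotheses `hMA` (mono-analytic type) and `hlift`
  (`GaloisIsoLiftsToTMPairIsoOfMonoAnalytic`) of `Rmk1111_a_of_monoAnalyticLifts` are NOT needed, and no named fact
  remains. (The instance at the GENUINE producers `AbsTopMonoids.genuineOfModel` / `genuineOfModelIsm`, whose
  `ContinuityLaws` / `IsTMPair` abc-iut-w6-d010 proved in `RadialExamplesEx18iiProofs.lean` p428606, is
  abc-iut-w6-d010's row «RMK1111A-GENUINE» (STATUS 06:40:48Z) and is NOT restated here; it is one `exact` away.)
* `Rmk1111_b_iff_kernel` — (b) `Rmk1111_b A zhatPow` is EQUIVALENT to its two kernel clauses (every pair over `1` is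
  a `Ẑ^×`-power; every `Ẑ^×`-power is `G`-equivariant): the genuine content of [AbsTopIII] Prop. 3.3 (ii), which stays
  where abc-iut-L6-t1 put it.

HONEST LABEL: interface-level theorems; the injectivity in (a) is the tree's Kummer-theoretic theorem
`pairIsoDeterminedByGalois_holds` consumed BY NAME; the kernel description in (b)/(c) ([AbsTopIII] Prop. 3.3 (ii) at
the genuine `Ẑ^×`-exponentiation) is NOT proved here. Nothing here bears on [IUTchIII] Cor. 3.12; no side is taken;
typed ≠ proved.
-/

namespace Literature.IUT.HodgeArakelov

open CategoryTheory
open Literature.AnabelianGeometry.AbsoluteAnabelian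
open Algebra.GrothendieckGroup (of)

universe u

/-! ## Pairs over `1 ∈ Aut(G)` -/

section Interface

variable {S : ThetaSetting.{u}} (A : AbsTopMonoids S)

/-- A pair `(1, ψ)` lies in `Aut(G ↷ M)` iff `ψ` commutes with the `G`-action ("the [`G`-linear] automorphisms
of `M`"). [claim: Mochizuki2012, status: disputed] (IUTchII §1 Rmk 1.11.1 (i), kurims p.50) -/
theorem PairAut.mem_over_one_iff {G : IsoClass S.Gk} {M : Type u} [Monoid M] (act : G.G →* MulAut M)
    (ψ : MulAut M) :
    ((1 : Aut G), ψ) ∈ PairAut G M act ↔ ∀ (g : G.G) (m : M), ψ (act g m) = act g (ψ m) :=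
  Iff.rfl

/-- The `M`-component of a pair automorphism over `1 ∈ Aut(G)` commutes with the `G`-action.
[claim: Mochizuki2012, status: disputed] (IUTchII §1 Rmk 1.11.1 (i), kurims p.50) -/
theorem PairAut.smul_comm_of_forget_eq_one {G : IsoClass S.Gk} {M : Type u} [Monoid M]
    {act : G.G →* MulAut M} (p : PairAut G M act) (hp : PairAut.forget p = 1) (g : G.G) (m : M) :
    p.1.2 (act g m) = act g (p.1.2 m) := by
  have h : p.1.2 (act g m) = act (IsoClass.homIso p.1.1.hom g) (p.1.2 m) := p.2 g m
  have h1 : p.1.1 = 1 := hp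
  rw [h1] at h
  exact h

/-! ## (a) `G ↷ O^⊳(G)`: the forgetful map is split surjective over EVERY `A` -/

/-- **IUTchII:Rmk1.11.1(i)** (a), surjectivity half, for EVERY inhabitant of the interface: every automorphism
`σ` of the topological group `G` lifts to the pair automorphism `(σ, O^⊳(σ))` of `G ↷ O^⊳(G)` — the functoriality
of `(∗⊳)` (`mapOtri_equivariant`). [claim: Mochizuki2012, status: disputed] (IUTchII §1 Rmk 1.11.1 (i), kurims p.50) -/
theorem PairAut.forget_surjective_actOtri (G : IsoClass S.Gk) :
    Function.Surjective (PairAut.forget (G := G) (act := A.actOtri G)) :=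
  fun σ => ⟨⟨(σ, A.mapOtri σ.hom), fun g m => A.mapOtri_equivariant σ.hom g m⟩, rfl⟩

/-- **IUTchII:Rmk1.11.1(i)** (a): the lift `σ ↦ (σ, O^⊳(σ))` is a GROUP HOMOMORPHISM `Aut(G) → Aut(G ↷ O^⊳(G))`
splitting the forgetful map (functor laws `mapOtri_id`, `mapOtri_comp`). [claim: Mochizuki2012, status: disputed]
(IUTchII §1 Rmk 1.11.1 (i), kurims p.50) -/
theorem PairAut.exists_section_actOtri (G : IsoClass S.Gk) :
    ∃ s : Aut G →* PairAut G (A.Otri G) (A.actOtri G), ∀ σ : Aut G, PairAut.forget (s σ) = σ := by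
  refine ⟨{ toFun := fun σ => ⟨(σ, A.mapOtri σ.hom), fun g m => A.mapOtri_equivariant σ.hom g m⟩
            map_one' := ?_
            map_mul' := ?_ }, fun σ => rfl⟩
  · refine Subtype.ext (Prod.ext rfl ?_)
    change A.mapOtri (𝟙 G) = MulEquiv.refl _
    exact A.mapOtri_id G
  · intro σ τ
    refine Subtype.ext (Prod.ext rfl ?_)
    change A.mapOtri (τ.hom ≫ σ.hom) = (A.mapOtri τ.hom).trans (A.mapOtri σ.hom)
    exact A.mapOtri_comp τ.hom σ.hom

/-- **IUTchII:Rmk1.11.1(i)** (a) ⟺ INJECTIVITY of the forgetful map (the surjectivity being free): `Rmk1111_a A`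
holds iff a pair automorphism of `G ↷ O^⊳(G)` is determined by its `G`-component — "[cf. [AbsTopIII],
Proposition 3.2, (iv)]". [claim: Mochizuki2012, status: disputed] (IUTchII §1 Rmk 1.11.1 (i), kurims p.50) -/
theorem Rmk1111_a_iff_forget_injective :
    Rmk1111_a A ↔
      ∀ G : IsoClass S.Gk, Function.Injective (PairAut.forget (G := G) (act := A.actOtri G)) :=
  ⟨fun h G => (h G).1, fun h G => ⟨h G, PairAut.forget_surjective_actOtri A G⟩⟩

/-! ## (b) `G ↷ O^×(G)`: the forgetful map is split surjective over EVERY `A` -/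

/-- **IUTchII:Rmk1.11.1(i)** (b), surjectivity clause, for EVERY inhabitant of the interface: every automorphism
`σ` of `G` lifts to the pair automorphism `(σ, O^×(σ))` of `G ↷ O^×(G)` (`O^×(σ) :=` the restriction of `O^⊳(σ)`
to units). [claim: Mochizuki2012, status: disputed] (IUTchII §1 Rmk 1.11.1 (i), kurims p.50) -/
theorem PairAut.forget_surjective_actOunits (G : IsoClass S.Gk) :
    Function.Surjective (PairAut.forget (G := G) (act := A.actOunits G)) := by
  intro σ
  refine ⟨⟨(σ, Units.mapEquiv (A.mapOtri σ.hom)), fun g u => Units.ext ?_⟩, rfl⟩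
  change A.mapOtri σ.hom (A.actOtri G g (u : A.Otri G)) =
    A.actOtri G (IsoClass.homIso σ.hom g) (A.mapOtri σ.hom (u : A.Otri G))
  exact A.mapOtri_equivariant σ.hom g u

/-- **IUTchII:Rmk1.11.1(i)** (b): the lift `σ ↦ (σ, O^×(σ))` is a group homomorphism splitting the forgetful map.
[claim: Mochizuki2012, status: disputed] (IUTchII §1 Rmk 1.11.1 (i), kurims p.50) -/
theorem PairAut.exists_section_actOunits (G : IsoClass S.Gk) :
    ∃ s : Aut G →* PairAut G (A.Ounits G) (A.actOunits G), ∀ σ : Aut G, PairAut.forget (s σ) = σ := by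
  have hmem : ∀ σ : Aut G, (σ, Units.mapEquiv (A.mapOtri σ.hom)) ∈ PairAut G (A.Ounits G) (A.actOunits G) := by
    intro σ g u
    refine Units.ext ?_
    change A.mapOtri σ.hom (A.actOtri G g (u : A.Otri G)) =
      A.actOtri G (IsoClass.homIso σ.hom g) (A.mapOtri σ.hom (u : A.Otri G))
    exact A.mapOtri_equivariant σ.hom g u
  refine ⟨{ toFun := fun σ => ⟨(σ, Units.mapEquiv (A.mapOtri σ.hom)), hmem σ⟩
            map_one' := ?_
            map_mul' := ?_ }, fun σ => rfl⟩
  · refine Subtype.ext (Prod.ext rfl (MulEquiv.ext fun u => Units.ext ?_))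
    change A.mapOtri (𝟙 G) (u : A.Otri G) = u
    rw [A.mapOtri_id]
    rfl
  · intro σ τ
    refine Subtype.ext (Prod.ext rfl (MulEquiv.ext fun u => Units.ext ?_))
    change A.mapOtri (τ.hom ≫ σ.hom) (u : A.Otri G) = A.mapOtri σ.hom (A.mapOtri τ.hom (u : A.Otri G))
    rw [A.mapOtri_comp]
    rfl

/-- **IUTchII:Rmk1.11.1(i)** (b), FIRST conjunct of the named fact `Rmk1111_b` (FACT-LIST F-0418), PROVED for every
`A` and every `zhatPow`. [claim: Mochizuki2012, status: disputed] (IUTchII §1 Rmk 1.11.1 (i), kurims p.50) -/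
theorem Rmk1111_b_surjective (G : IsoClass S.Gk) :
    Function.Surjective (PairAut.forget (G := G) (act := A.actOunits G)) :=
  PairAut.forget_surjective_actOunits A G

/-- **IUTchII:Rmk1.11.1(i)** (b) REDUCED TO ITS KERNEL CLAUSES: `Rmk1111_b A zhatPow` holds iff (every pair
automorphism of `G ↷ O^×(G)` over `1 ∈ Aut(G)` is a `Ẑ^×`-power `zhatPow G u`) and (every `zhatPow G u` is
`G`-equivariant) — "[the] kernel given by the … automorphisms … determined by the natural action of `Ẑ^×`
[cf. [AbsTopIII], Proposition 3.3, (ii)]", the surjectivity being free. [claim: Mochizuki2012, status: disputed]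
(IUTchII §1 Rmk 1.11.1 (i), kurims p.50) -/
theorem Rmk1111_b_iff_kernel (zhatPow : ∀ G : IsoClass S.Gk, ZHatUnits →* MulAut (A.Ounits G)) :
    Rmk1111_b A zhatPow ↔
      ∀ G : IsoClass S.Gk,
        (∀ p : PairAut G (A.Ounits G) (A.actOunits G),
            PairAut.forget p = 1 → ∃ u : ZHatUnits, p.1.2 = zhatPow G u) ∧
          ∀ (u : ZHatUnits) (g : G.G) (x : A.Ounits G),
            zhatPow G u (A.actOunits G g x) = A.actOunits G g (zhatPow G u x) :=
  ⟨fun h G => ⟨(h G).2.1, fun u => (PairAut.mem_over_one_iff (A.actOunits G) (zhatPow G u)).mp ((h G).2.2 u)⟩,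
    fun h G => ⟨PairAut.forget_surjective_actOunits A G, (h G).1,
      fun u => (PairAut.mem_over_one_iff (A.actOunits G) (zhatPow G u)).mpr ((h G).2 u)⟩⟩

/-! ## (c) `G ↷ O^gp(G)`: the forgetful map is split surjective for the induced action (`(∗gp)`) -/

/-- **IUTchII:Rmk1.11.1(i)** (c) for the groupification `G ↷ O^gp(G)` ([IUTchII] Ex. 1.8 (vii) `(∗gp)`; in the
`(∗ĝp) := (∗gp)` reading of p425301 this is the first conjunct of `Rmk1111_c`): for the action `ρ` induced on
`O^gp(G)` (`existsUnique_actOgp`), every `σ ∈ Aut(G)` lifts to the pair automorphism `(σ, O^gp(σ))`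
(`existsUnique_mapOgp`, `mapOgp_equivariant`). [claim: Mochizuki2012, status: disputed]
(IUTchII §1 Rmk 1.11.1 (i), kurims p.50) -/
theorem PairAut.forget_surjective_ogp (G : IsoClass S.Gk) {ρ : G.G →* MulAut (A.Ogp G)}
    (hρ : ∀ (g : G.G) (m : A.Otri G), ρ g (of m) = of (A.actOtri G g m)) :
    Function.Surjective (PairAut.forget (G := G) (act := ρ)) := by
  intro σ
  obtain ⟨φ, hφ, -⟩ := A.existsUnique_mapOgp σ.hom
  exact ⟨⟨(σ, φ), fun g x => A.mapOgp_equivariant σ.hom hρ hρ hφ g x⟩, rfl⟩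

/-- **IUTchII:Rmk1.11.1(i)** (c) for `(∗gp)`, split form: with the induced actions `ρ_G` and the functorial
transports `O^gp(f)` of `exists_gpAlgorithm_G` (p428334), `σ ↦ (σ, O^gp(σ))` is a group homomorphism splitting
the forgetful map, at every `G`. [claim: Mochizuki2012, status: disputed] (IUTchII §1 Rmk 1.11.1 (i), kurims p.50) -/
theorem PairAut.exists_section_ogp :
    ∃ ρ : ∀ G : IsoClass S.Gk, G.G →* MulAut (A.Ogp G),
      (∀ (G : IsoClass S.Gk) (g : G.G) (m : A.Otri G), ρ G g (of m) = of (A.actOtri G g m)) ∧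
      ∀ G : IsoClass S.Gk, ∃ s : Aut G →* PairAut G (A.Ogp G) (ρ G), ∀ σ : Aut G, PairAut.forget (s σ) = σ := by
  obtain ⟨ρ, φ, hρ, -, hid, hcomp, hequiv⟩ := A.exists_gpAlgorithm_G
  refine ⟨ρ, hρ, fun G => ?_⟩
  refine ⟨{ toFun := fun σ => ⟨(σ, φ σ.hom), fun g x => hequiv σ.hom g x⟩
            map_one' := ?_
            map_mul' := ?_ }, fun σ => rfl⟩
  · refine Subtype.ext (Prod.ext rfl ?_)
    change φ (𝟙 G) = MulEquiv.refl _
    exact hid G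
  · intro σ τ
    refine Subtype.ext (Prod.ext rfl ?_)
    change φ (τ.hom ≫ σ.hom) = (φ τ.hom).trans (φ σ.hom)
    exact hcomp τ.hom σ.hom

end Interface

/-! ## (a) PROVED for every `TM`-pair inhabitant (no mono-analytic / lifting hypothesis, no named fact) -/

section TMPair

variable {S : ThetaSetting.{0}} (A : AbsTopMonoids S) (hA : A.ContinuityLaws)

/-- **IUTchII:Rmk1.11.1(i)** (a) PROVED over every inhabitant of the interface with continuity laws whose pairs
`G ↷ O^⊳(G)` are MLF-Galois `TM`-pairs: surjectivity is the functoriality of `(∗⊳)`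
(`PairAut.forget_surjective_actOtri`), injectivity is [AbsTopIII] Prop. 3.2 (iv) — the tree's THEOREM
`pairIsoDeterminedByGalois_holds` (abc-iut-L6-t13; a pair automorphism IS an isomorphism of [AbsTopIII] pairs
`toPair G ⥲ toPair G`, as in abc-iut-L6-t23's `Rmk1111_a_of_monoAnalyticLifts`, whose hypotheses `hMA`, `hlift` are
dropped and `hdet` discharged). [claim: Mochizuki2012, status: disputed] (IUTchII §1 Rmk 1.11.1 (i), kurims p.50) -/
theorem Rmk1111_a_of_isTMPair (hTM : ∀ G, A.IsTMPair hA G) : Rmk1111_a A := by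
  refine (Rmk1111_a_iff_forget_injective A).mpr fun G p q hpq => ?_
  have hpq' : p.1.1 = q.1.1 := hpq
  have hp : ∀ (g : G.G) (m : A.Otri G),
      p.1.2 (A.actOtri G g m) = A.actOtri G (IsoClass.homIso p.1.1.hom g) (p.1.2 m) := p.2
  have hq : ∀ (g : G.G) (m : A.Otri G),
      q.1.2 (A.actOtri G g m) = A.actOtri G (IsoClass.homIso q.1.1.hom g) (q.1.2 m) := q.2
  -- a `PairAut` element IS an isomorphism of [AbsTopIII] pairs `toPair G ≅ toPair G`
  let ep : GaloisMonoidPair.Iso (A.toPair hA G) (A.toPair hA G) :=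
    ⟨IsoClass.homIso p.1.1.hom, p.1.2, fun g m => hp g m⟩
  let eq' : GaloisMonoidPair.Iso (A.toPair hA G) (A.toPair hA G) :=
    ⟨IsoClass.homIso q.1.1.hom, q.1.2, fun g m => hq g m⟩
  have hM : ep.isoM = eq'.isoM :=
    pairIsoDeterminedByGalois_holds _ _ (hTM G) (hTM G) ep eq'
      (by change IsoClass.homIso p.1.1.hom = IsoClass.homIso q.1.1.hom; rw [hpq'])
  exact Subtype.ext (Prod.ext hpq' hM)

/-- **IUTchII:Rmk1.11.1(i)** (a), the `TM`-pair condition checked at ONE object of the connected groupoid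
`IsoClass G_k` (e.g. the reference `G_k`). [claim: Mochizuki2012, status: disputed] (IUTchII §1 Rmk 1.11.1 (i), kurims p.50) -/
theorem Rmk1111_a_of_isTMPair_of_exists (hTM : ∃ G, A.IsTMPair hA G) : Rmk1111_a A :=
  Rmk1111_a_of_isTMPair A hA (A.isTMPair_forall_of_exists hA hTM)

end TMPair

end Literature.IUT.HodgeArakelov
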